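import Summits.CriticalPhenomena.PercolationContinuityZ3.Theorems.PercNearOneGluingNoHeavyQuantSDEC
import HarnessLib

/-!
# QUANT lane R8, heavy node, REGIME R (`k ≥ min(t₁,t₂)`): S* + weight-1 reflections `c = 0` on the upper rows — the certificate in the
# q-free (E0)+(E1) format, ABSTRACTLY over arm-2's S* data (`LawDec.regimeR_certificate_of_pointwise`)

builds on p205010 (kernel theorem, internal audit signed; external expert review pending)

Support file (`--supports stmt-CriticalPhenomena-4575`), QUANT lane typer seat prim-quant-stmt (gen 34); memo
`run/shared/lean/prim/quant/prim-quant-stmt-g34/PHANTOM-QFREE-G34.md` §4.  Theorems only, standard axioms, no sorries; imports only `…QuantSDEC`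
(Mathlib), so that it elaborates ahead of the farm backlog on arm-2 g38's `…QuantTwoLayerHalf{Pointwise,Rows,Need}`.

THE CERTIFICATE (orientation `t₂ ≤ k`; `2k < t₁ + t₂` then forces `k < t₁`): rows `s ≤ k` carry arm-2's S* reflection `c s` with weight 1, rows
`s > k` carry the reflection `c = 0` with weight 1, columns carry S*'s need profile as layer-cake weights `kap a c = need a c − need a (c+1)`; no
tilts.  (E1) holds because every row has weight 1.  (E0) is S*'s pointwise inequality (★) (arm-2 `halfCert_pointwise`; here the HYPOTHESIS `hS`,
divided by `1 − y`) plus two observations for the upper rows: the added functional `[t₁ ≤ a] − u[a ≤ 0]` is `≤ 0` on `a < t₁`, and on `a ≥ t₁` the cell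
`(a, s > k)` is a target (`a + s ≥ t₁ + k + 1 ≥ t₁ + t₂ − k`) where S* contributes nothing: the row `s > k` is inactive and `need a · = 0`, because
every U/W-cell `(a, s″)` of S* has `a + s″ < t₁ + t₂ − k ≤ t₁` when `k ≥ t₂` (hypothesis `Npos`).
**`regimeR_certificate_of_pointwise`** packages this: GIVEN abstract S* data (`act`, `c`, `need`) with the listed properties and (★) at every cell of
the grid, it returns `lam kap` satisfying the hypotheses `hlam0 hlamv hkap0 hkapv hE0 hE1` of `LawDec.gate_lconv_row_of_universalCertificate` with
`ρ₁ = ρ₂ = 0`.  The remaining assembly (instantiate with the concrete S* data of arm-2's `twoLayer_lconv_of_half_le` and its `halfCert_pointwise`,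
then the principle) waits only for the farm to build those modules.  Exact check of the resulting explicit certificate: typer g34 `explore/sstar_R.py`,
`thmB_cert.py`, kit j218836 (1 130 452 instances with both regimes / 0).
HONEST STATUS: `TLBGateConvClosedHeavy`, `FarTreeRowHeavy`, `FarTreeRow` OPEN until that assembly lands.

[this work]; S*: prim-quant-arm-2 g38 (THEOREM-A-PROOF.md, `…QuantTwoLayerHalfPointwise`).  The gluing rows served
[cite: KozmaNitzan2024, Conjecture 3 (p. 15)]; product measure [cite: Grimmett1999, §1.3 p. 10].
-/

noncomputable section

namespace Summit.CriticalPhenomena.PercolationContinuityZ3.Theorems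

namespace Quant

open Finset

namespace LawDec

/-- layer-cake telescoping: for `f` vanishing above `M`, `Σ_{c ≤ M} (f c − f (c+1))·[m ≤ c] = f m`. [this work] -/
theorem sum_sub_succ_mul_indicator (f : ℕ → ℝ) (M m : ℕ) (hz : ∀ j, M < j → f j = 0) :
    ∑ cc ∈ Finset.range (M + 1), (f cc - f (cc + 1)) * (if m ≤ cc then (1 : ℝ) else 0) = f m := by
  have key : ∀ n : ℕ, ∑ cc ∈ Finset.range (n + 1), (f cc - f (cc + 1)) * (if m ≤ cc then (1 : ℝ) else 0)
      = if m ≤ n then f m - f (n + 1) else 0 := by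
    intro n
    induction n with
    | zero =>
      rw [Finset.sum_range_one]
      by_cases hm : m ≤ 0
      · rw [if_pos hm, if_pos hm, Nat.le_zero.mp hm]; ring
      · rw [if_neg hm, if_neg hm]; ring
    | succ n ih =>
      rw [Finset.sum_range_succ, ih]
      by_cases h1 : m ≤ n
      · rw [if_pos h1, if_pos (h1.trans (Nat.le_succ n)), if_pos (h1.trans (Nat.le_succ n))]; ring
      · by_cases h2 : m ≤ n + 1
        · have hm : m = n + 1 := le_antisymm h2 (Nat.succ_le_of_lt (not_le.mp h1))
          rw [if_neg h1, if_pos h2, if_pos h2, hm]; ring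
        · rw [if_neg h1, if_neg h2, if_neg h2]; ring
  rw [key M]
  by_cases hm : m ≤ M
  · rw [if_pos hm, hz (M + 1) (Nat.lt_succ_self M)]; ring
  · rw [if_neg hm, hz m (not_le.mp hm)]

/-- **REGIME R OF THE HEAVY NODE: S* + UPPER ROWS, PACKAGED FOR THE q-FREE PRINCIPLE** (typer g34, memo §4).  Data: `1/2 ≤ y < 1`
(`u = y/(1−y) ≥ 1`), targets `0 < t₁ ≤ M₁`, `t₂`, a layer `k` with `t₂ ≤ k` (`2k < t₁ + t₂` is carried by `hS`); abstract S* row data `act`, `c` (every row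
`s ≤ k` active, active rows have `s ≤ k` and `2·c s < t₁`) and column profile `need` (nonnegative, vanishing above `M₂`, antitone in the row,
a strict drop `need a (c+1) < need a c` only on rows `2c < t₂`, positivity only in columns meeting the complement of the target:
`0 < need a s → ∃ s″, a + s″ < t₁ + t₂ − k` — all consequences of `halfCert_pointwise`'s `N0 … Npos`), and S*'s pointwise inequality `hS` at every
cell of `{0..M₁}×{0..M₂}`.  CONCLUSION: weights `lam`, `kap` with the hypotheses `hlam0 hlamv hkap0 hkapv hE0 hE1` of
`LawDec.gate_lconv_row_of_universalCertificate` for `ρ₁ = ρ₂ = 0` (the tilt terms `0·(a − t₁) + 0·(s − t₂)` are omitted). [this work] -/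
theorem regimeR_certificate_of_pointwise (y t₁ t₂ : ℝ) (M₁ M₂ k : ℕ) (hy : 1 / 2 ≤ y) (hy1 : y < 1)
    (ht₁ : 0 < t₁) (ht₁M : t₁ ≤ M₁) (hR : t₂ ≤ k)
    (act : ℕ → Prop) [DecidablePred act] (c : ℕ → ℕ)
    (hact : ∀ s, s ≤ k → act s) (hactk : ∀ s, act s → s ≤ k) (H1 : ∀ s, act s → 2 * (c s : ℝ) < t₁)
    (need : ℕ → ℕ → ℝ) (N0 : ∀ a s, 0 ≤ need a s) (Nz : ∀ a s, M₂ < s → need a s = 0)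
    (Nmono : ∀ a s, need a (s + 1) ≤ need a s)
    (Nval : ∀ a cc, need a (cc + 1) < need a cc → 2 * (cc : ℝ) < t₂)
    (Npos : ∀ a s, 0 < need a s → ∃ s'' : ℕ, (a : ℝ) + s'' < t₁ + t₂ - k)
    (hS : ∀ a ∈ Finset.range (M₁ + 1), ∀ s ∈ Finset.range (M₂ + 1),
      (if act s then (1 - y) * (if t₁ - c s ≤ (a : ℝ) then (1 : ℝ) else 0) - y * (if a ≤ c s then (1 : ℝ) else 0) else 0)
        + (1 - y) * need a ⌈t₂ - s⌉₊ - y * need a s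
        ≤ (1 - y) * (if t₁ + t₂ - k ≤ (a : ℝ) + s then (1 : ℝ) else 0) - y * (if a + s ≤ k then (1 : ℝ) else 0)) :
    ∃ lam kap : ℕ → ℕ → ℝ,
      (∀ s cc, 0 ≤ lam s cc) ∧ (∀ s cc, 0 < lam s cc → 2 * (cc : ℝ) < t₁)
      ∧ (∀ a cc, 0 ≤ kap a cc) ∧ (∀ a cc, 0 < kap a cc → 2 * (cc : ℝ) < t₂)
      ∧ (∀ a ∈ Finset.range (M₁ + 1), ∀ s ∈ Finset.range (M₂ + 1),
          (∑ cc ∈ Finset.range (M₁ + 1), lam s cc *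
              ((if t₁ - cc ≤ (a : ℝ) then (1 : ℝ) else 0) - y / (1 - y) * (if a ≤ cc then (1 : ℝ) else 0)))
          + (∑ cc ∈ Finset.range (M₂ + 1), kap a cc *
              ((if t₂ - cc ≤ (s : ℝ) then (1 : ℝ) else 0) - y / (1 - y) * (if s ≤ cc then (1 : ℝ) else 0)))
          ≤ (if t₁ + t₂ - k ≤ ((a + s : ℕ) : ℝ) then (1 : ℝ) else 0) - y / (1 - y) * (if a + s ≤ k then (1 : ℝ) else 0))
      ∧ (∀ a ∈ Finset.range (M₁ + 1), ∀ s ∈ Finset.range (M₂ + 1),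
          1 ≤ (∑ cc ∈ Finset.range (M₁ + 1), lam s cc) + (∑ cc ∈ Finset.range (M₂ + 1), kap a cc)) := by
  have hy0 : 0 < y := by linarith
  have h1y : 0 < 1 - y := by linarith
  have hk0 : (0 : ℝ) ≤ k := Nat.cast_nonneg k
  set u : ℝ := y / (1 - y) with hu
  -- row data in range: `c s < M₁ + 1` on active rows
  have hcM : ∀ s, act s → c s ∈ Finset.range (M₁ + 1) := by
    intro s hs
    rw [Finset.mem_range]
    have h := H1 s hs
    have : (c s : ℝ) < (M₁ : ℝ) + 1 := by linarith
    exact_mod_cast this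
  have h0M : 0 ∈ Finset.range (M₁ + 1) := Finset.mem_range.2 (Nat.succ_pos M₁)
  -- the column sums telescope
  have hcol : ∀ a s : ℕ, ∑ cc ∈ Finset.range (M₂ + 1), (need a cc - need a (cc + 1)) *
      ((if t₂ - cc ≤ (s : ℝ) then (1 : ℝ) else 0) - u * (if s ≤ cc then (1 : ℝ) else 0))
      = need a ⌈t₂ - s⌉₊ - u * need a s := by
    intro a s
    have e : ∀ cc : ℕ, (need a cc - need a (cc + 1)) *
        ((if t₂ - cc ≤ (s : ℝ) then (1 : ℝ) else 0) - u * (if s ≤ cc then (1 : ℝ) else 0))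
        = (need a cc - need a (cc + 1)) * (if ⌈t₂ - s⌉₊ ≤ cc then (1 : ℝ) else 0)
          - u * ((need a cc - need a (cc + 1)) * (if s ≤ cc then (1 : ℝ) else 0)) := by
      intro cc
      have hiff : (t₂ - cc ≤ (s : ℝ)) ↔ (⌈t₂ - s⌉₊ ≤ cc) := by
        rw [Nat.ceil_le]; constructor <;> intro h <;> linarith
      by_cases h1 : ⌈t₂ - s⌉₊ ≤ cc
      · rw [if_pos (hiff.mpr h1), if_pos h1]; ring
      · rw [if_neg (fun h => h1 (hiff.mp h)), if_neg h1]; ring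
    simp_rw [e]
    rw [Finset.sum_sub_distrib, ← Finset.mul_sum, sum_sub_succ_mul_indicator _ M₂ _ (Nz a),
      sum_sub_succ_mul_indicator _ M₂ _ (Nz a)]
  -- `need` vanishes on columns `a ≥ t₁` (no U/W-cell there, since `k ≥ t₂`)
  have hneed_far : ∀ a s : ℕ, t₁ ≤ (a : ℝ) → need a s = 0 := by
    intro a s ha
    by_contra hne
    have hpos : 0 < need a s := lt_of_le_of_ne (N0 a s) (Ne.symm hne)
    obtain ⟨s'', hs''⟩ := Npos a s hpos
    have : (0 : ℝ) ≤ s'' := Nat.cast_nonneg s''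
    linarith
  refine ⟨fun s cc => if s ≤ k then (if cc = c s then 1 else 0) else (if cc = 0 then 1 else 0),
          fun a cc => need a cc - need a (cc + 1), ?_, ?_, ?_, ?_, ?_, ?_⟩
  · intro s cc; dsimp only; split_ifs <;> norm_num
  · intro s cc h
    dsimp only at h
    split_ifs at h with hsk hcc hcc0
    · rw [hcc]; exact H1 s (hact s hsk)
    · exact (lt_irrefl _ h).elim
    · rw [hcc0]; push_cast; linarith
    · exact (lt_irrefl _ h).elim
  · intro a cc; exact sub_nonneg.mpr (Nmono a cc)
  · intro a cc h; exact Nval a cc (by linarith)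
  · -- (E0)
    intro a ha s hs
    have hS' := hS a ha s hs
    dsimp only
    rw [hcol a s]
    -- row sum
    have hrow : ∑ cc ∈ Finset.range (M₁ + 1),
        (if s ≤ k then (if cc = c s then (1 : ℝ) else 0) else (if cc = 0 then (1 : ℝ) else 0)) *
          ((if t₁ - cc ≤ (a : ℝ) then (1 : ℝ) else 0) - u * (if a ≤ cc then (1 : ℝ) else 0))
        = if s ≤ k then ((if t₁ - c s ≤ (a : ℝ) then (1 : ℝ) else 0) - u * (if a ≤ c s then (1 : ℝ) else 0))
          else ((if t₁ - (0 : ℕ) ≤ (a : ℝ) then (1 : ℝ) else 0) - u * (if a ≤ 0 then (1 : ℝ) else 0)) := by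
      by_cases hsk : s ≤ k
      · simp only [hsk, if_true]
        rw [show (∑ cc ∈ Finset.range (M₁ + 1), (if cc = c s then (1 : ℝ) else 0) *
              ((if t₁ - cc ≤ (a : ℝ) then (1 : ℝ) else 0) - u * (if a ≤ cc then (1 : ℝ) else 0)))
            = ∑ cc ∈ Finset.range (M₁ + 1), (if cc = c s then
              ((if t₁ - cc ≤ (a : ℝ) then (1 : ℝ) else 0) - u * (if a ≤ cc then (1 : ℝ) else 0)) else 0) from
            Finset.sum_congr rfl fun cc _ => by split_ifs <;> simp]
        rw [Finset.sum_ite_eq' (Finset.range (M₁ + 1)) (c s), if_pos (hcM s (hact s hsk))]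
      · simp only [hsk, if_false]
        rw [show (∑ cc ∈ Finset.range (M₁ + 1), (if cc = 0 then (1 : ℝ) else 0) *
              ((if t₁ - cc ≤ (a : ℝ) then (1 : ℝ) else 0) - u * (if a ≤ cc then (1 : ℝ) else 0)))
            = ∑ cc ∈ Finset.range (M₁ + 1), (if cc = 0 then
              ((if t₁ - cc ≤ (a : ℝ) then (1 : ℝ) else 0) - u * (if a ≤ cc then (1 : ℝ) else 0)) else 0) from
            Finset.sum_congr rfl fun cc _ => by split_ifs <;> simp]
        rw [Finset.sum_ite_eq' (Finset.range (M₁ + 1)) 0, if_pos h0M]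
    rw [hrow]
    -- the target kernel with the cast pushed
    have hKcast : (if t₁ + t₂ - k ≤ ((a + s : ℕ) : ℝ) then (1 : ℝ) else 0) = (if t₁ + t₂ - k ≤ (a : ℝ) + s then (1 : ℝ) else 0) := by
      push_cast; rfl
    rw [hKcast]
    -- divide `hS` by `1 − y`
    have hS'' : (if act s then ((if t₁ - c s ≤ (a : ℝ) then (1 : ℝ) else 0) - u * (if a ≤ c s then (1 : ℝ) else 0)) else 0)
        + need a ⌈t₂ - s⌉₊ - u * need a s
        ≤ (if t₁ + t₂ - k ≤ (a : ℝ) + s then (1 : ℝ) else 0) - u * (if a + s ≤ k then (1 : ℝ) else 0) := by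
      rw [hu]
      have e1 : (if act s then ((if t₁ - c s ≤ (a : ℝ) then (1 : ℝ) else 0) - y / (1 - y) * (if a ≤ c s then (1 : ℝ) else 0)) else 0)
          + need a ⌈t₂ - s⌉₊ - y / (1 - y) * need a s
          = (1 / (1 - y)) * ((if act s then (1 - y) * (if t₁ - c s ≤ (a : ℝ) then (1 : ℝ) else 0)
              - y * (if a ≤ c s then (1 : ℝ) else 0) else 0) + (1 - y) * need a ⌈t₂ - s⌉₊ - y * need a s) := by
        by_cases hA : act s
        · rw [if_pos hA, if_pos hA]
          field_simp
          try ring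
        · rw [if_neg hA, if_neg hA]
          field_simp
          try ring
      have e2 : (if t₁ + t₂ - k ≤ (a : ℝ) + s then (1 : ℝ) else 0) - y / (1 - y) * (if a + s ≤ k then (1 : ℝ) else 0)
          = (1 / (1 - y)) * ((1 - y) * (if t₁ + t₂ - k ≤ (a : ℝ) + s then (1 : ℝ) else 0) - y * (if a + s ≤ k then (1 : ℝ) else 0)) := by
        field_simp
      rw [e1, e2]
      exact mul_le_mul_of_nonneg_left hS' (by positivity)
    by_cases hsk : s ≤ k
    · rw [if_pos hsk]
      rw [if_pos (hact s hsk)] at hS''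
      linarith
    · rw [if_neg hsk]
      have hsk' : k < s := not_le.mp hsk
      rw [if_neg (fun h => hsk (hactk s h))] at hS''
      simp only [Nat.cast_zero, sub_zero]
      by_cases hat : t₁ ≤ (a : ℝ)
      · -- far column: target cell, S* silent
        have hm : need a ⌈t₂ - s⌉₊ = 0 := hneed_far a _ hat
        have hn : need a s = 0 := hneed_far a _ hat
        have htgt : t₁ + t₂ - k ≤ (a : ℝ) + s := by
          have : (k : ℝ) + 1 ≤ s := by exact_mod_cast hsk'
          linarith
        have hnl : ¬ (a + s ≤ k) := by omega
        rw [hm, hn, if_pos hat, if_pos htgt, if_neg hnl]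
        have ha0 : ¬ (a ≤ 0) := by
          intro h
          have : (a : ℝ) ≤ 0 := by exact_mod_cast h
          linarith
        rw [if_neg ha0]; norm_num
      · rw [if_neg hat]
        have : - u * (if a ≤ 0 then (1 : ℝ) else 0) ≤ 0 := by
          have hu0 : 0 ≤ u := (div_pos hy0 h1y).le
          split_ifs <;> nlinarith
        linarith
  · -- (E1): every row has weight exactly 1, columns `need a 0 ≥ 0`
    intro a ha s hs
    dsimp only
    have hrow1 : ∑ cc ∈ Finset.range (M₁ + 1),
        (if s ≤ k then (if cc = c s then (1 : ℝ) else 0) else (if cc = 0 then (1 : ℝ) else 0)) = 1 := by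
      by_cases hsk : s ≤ k
      · simp only [hsk, if_true]
        rw [Finset.sum_ite_eq' (Finset.range (M₁ + 1)) (c s), if_pos (hcM s (hact s hsk))]
      · simp only [hsk, if_false]
        rw [Finset.sum_ite_eq' (Finset.range (M₁ + 1)) 0, if_pos h0M]
    have hcol0 : ∑ cc ∈ Finset.range (M₂ + 1), (need a cc - need a (cc + 1)) = need a 0 := by
      have := sum_sub_succ_mul_indicator (need a) M₂ 0 (Nz a)
      simpa using this
    rw [hrow1, hcol0]
    linarith [N0 a 0]

end LawDec

end Quant

end Summit.CriticalPhenomena.PercolationContinuityZ3.Theorems
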